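import Summits.HodgeConjecture.HodgeConjecture.Theorems.Ring2WeilCoverageCMFieldNormResidueSymbolsDyadic
import Summits.HodgeConjecture.HodgeConjecture.Theorems.Ring2WeilCoverageCMFieldNormResidueSymbolsDyadicResidueFields
import HarnessLib

/-!
# Ring 2 — Weil-family coverage, CM-field rows: THE DYADIC COLUMN of the `T`-labels for the census carriers `ℚ(ζ₅)`,
  `ℚ(ζ₁₂)`, `ℚ(√-3,√5)` (the carriers unramified above `2` in `E/F`) — sub-cell (ix″) instantiated
  (WEIL-FAMILY-COVERAGE «## b03», part 8)

research route conditional on HC_CM; not a corollary; Q11.4-sentence-2 already refuted in dim ≥ 3.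

On Deligne's carriers `F = ℚ[S]/(R) = ℚ(θ) ⊂ E = F(√θ)` the rows `W_{2k}.E.δ` are labelled by `T(q) = badPlaces q θ`
[cite: Deligne1982HodgeCycles, §4: display (1), Prop. 4.1, Cor. 4.2]; `Ring2WeilCoverageCMFieldNormResidueSymbolsDyadic` gave
the dyadic membership in closed form under a dyadic normalisation `θ = c²(1 + 4ρ)` [cite: Omeara1963, §63C Example 63:16].
Here the normalisation is EXHIBITED and the Artin–Schreier residue equation DECIDED for three census fields of §b03.5:

* §15 `ℚ(ζ₅)` (`R = S² + 5S + 5`, `F = ℚ(√5)`): `θ = (θ+3)²(1 + 4(θ+1))`; `X² - X - (θ+1)` has NO root mod `v₂`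
  (`𝓞_F/v₂ = 𝔽₄`, trace `1`): the dyadic place is INERT, unique, `= (2)`, `ord 2 = 1`, and
  **`v₂ ∈ T(q) ⟺ ord_{v₂} q` odd** (`zeta5_inl_mem_badPlaces_iff_odd_of_dyadic`); the dyadic rows `[2w] ≠ [(-1)^k]`.
* §16 `ℚ(ζ₁₂)` (`R = S² + 8S + 4`, `F = ℚ(√3)`, `2 = (1+√3)²·unit` ramified in `F`): `θ = ((θ+2)/(θ+4))²·(-3)`;
  `𝓞_F/v₂ = 𝔽₂` has no cube root of unity: INERT, **`v₂ ∈ T(q) ⟺ ord_{v₂} q` odd**, and since `ord_{v₂} 2 = 2`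
  **no row `[2^a w]` (`w` a dyadic unit, e.g. an odd integer) contains `v₂`** — every `T`-set of the `ℚ(ζ₁₂)` table avoids `2`.
* §17 `ℚ(√-3,√5)` (`R = S² + 9S + 9`, `F = ℚ(√5)`): `θ = ((θ+3)/3)²·(-3)`; `r = θ` IS a root of `X² - X + 1` mod `v₂`
  (`θ² - θ + 1 = -2(5θ+4)`): the dyadic place is SPLIT and **lies in no `T(q)`**.
These are the dyadic entries of §b03.5's `T`-sets (PARI tier C) as kernel theorems; the four dyadic-RAMIFIED carriers
(`ℚ(ζ₈)`, `ℚ(i,√5)`, `ℚ(√-(2+√2))`, `ℚ(√-(3+√2))`) are served by the parity complement of part 6.  No new definition, no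
named fact, no sorry; nothing about the Hodge conjecture is asserted.
-/

noncomputable section

set_option linter.dupNamespace false

open Polynomial NumberField IsDedekindDomain

namespace Summit.HodgeConjecture.HodgeConjecture.Ring2.WeilCoverageCM

open Literature.AlgebraicGeometry.Deligne1982
open Literature.AlgebraicGeometry.HodgeTheory (splitDiscriminantClassCM)
open Literature.NumberTheory.QuadraticForms

/-! ### §15 `E = ℚ(ζ₅)`, `F = ℚ(√5)`, `R = S² + 5S + 5`: the dyadic place is INERT — `v₂ ∈ T(q) ⟺ ord₂ q` odd -/

section Zeta5

variable {R : Polynomial ℤ} [Fact (Irreducible (cmPolyQ R))] [Fact (Irreducible (realPolyQ R))]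

omit [Fact (Irreducible (cmPolyQ R))] in
/-- **Dyadic normalisation of the `ℚ(ζ₅)` carrier**: `θ = (θ + 3)²·(1 + 4(θ + 1))` in `F = ℚ[S]/(S² + 5S + 5)`
(`θ = (-5 ± √5)/2 = ω² - 4 = ω²(1 + 4(ω - 2))`, `ω = θ + 3` the golden unit). [folklore] -/
theorem zeta5_root_eq_sq_mul_one_add_four_mul (hR : R = X ^ 2 + C 5 * X + C 5) {θₒ : 𝓞 (realField R)}
    (hθ : (θₒ : realField R) = AdjoinRoot.root (realPolyQ R)) :
    AdjoinRoot.root (realPolyQ R) =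
      (AdjoinRoot.root (realPolyQ R) + 3) ^ 2 * ((1 + 4 * (θₒ + 1) : 𝓞 (realField R)) : realField R) := by
  have hrel := root_rel hR
  simp only [map_add, map_mul, map_one, map_ofNat, hθ]
  linear_combination (-(4 * AdjoinRoot.root (realPolyQ R) + 9)) * hrel

omit [Fact (Irreducible (cmPolyQ R))] in
/-- `θ² - θ ∉ v` at a dyadic place (`θ² - θ = -6θ - 5 ≡ 1`): the residue field of `ℚ(√5)` at `2` is `𝔽₄`, not `𝔽₂`.
[folklore] -/
theorem zeta5_sq_sub_self_notMem (hR : R = X ^ 2 + C 5 * X + C 5) {θₒ : 𝓞 (realField R)}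
    (hθ : (θₒ : realField R) = AdjoinRoot.root (realPolyQ R)) (v : HeightOneSpectrum (𝓞 (realField R)))
    (h2 : (2 : 𝓞 (realField R)) ∈ v.asIdeal) : θₒ ^ 2 - θₒ ∉ v.asIdeal := by
  have hrel : θₒ ^ 2 + 5 * θₒ + 5 = 0 := by simpa using ringOfIntegers_root_rel_quadratic hR hθ
  intro h
  have h1 : (1 : 𝓞 (realField R)) = (θₒ ^ 2 + 5 * θₒ + 5) - (θₒ ^ 2 - θₒ) - 2 * (3 * θₒ + 2) := by ring
  rw [hrel, zero_sub] at h1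
  have hmem : (1 : 𝓞 (realField R)) ∈ v.asIdeal := by
    rw [h1]
    exact v.asIdeal.sub_mem (v.asIdeal.neg_mem h) (v.asIdeal.mul_mem_right _ h2)
  exact v.isPrime.ne_top ((Ideal.eq_top_iff_one _).2 hmem)

omit [Fact (Irreducible (cmPolyQ R))] in
/-- **The dyadic place of `ℚ(√5)` is `(2)`** (inert), in the carrier's own terms. [folklore] -/
theorem zeta5_dyadic_asIdeal_eq_span_two (hR : R = X ^ 2 + C 5 * X + C 5) {θₒ : 𝓞 (realField R)}
    (hθ : (θₒ : realField R) = AdjoinRoot.root (realPolyQ R)) (v : HeightOneSpectrum (𝓞 (realField R)))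
    (h2 : (2 : 𝓞 (realField R)) ∈ v.asIdeal) : v.asIdeal = Ideal.span {(2 : 𝓞 (realField R))} :=
  asIdeal_eq_span_two_of_dyadic_of_sq_sub_self_notMem (finrank_realField_quadratic hR) v h2
    (zeta5_sq_sub_self_notMem hR hθ v h2)

omit [Fact (Irreducible (cmPolyQ R))] in
/-- … it is the UNIQUE dyadic place of `F = ℚ(√5)`. [folklore] -/
theorem zeta5_dyadic_unique (hR : R = X ^ 2 + C 5 * X + C 5) {θₒ : 𝓞 (realField R)}
    (hθ : (θₒ : realField R) = AdjoinRoot.root (realPolyQ R)) (v v' : HeightOneSpectrum (𝓞 (realField R)))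
    (h2 : (2 : 𝓞 (realField R)) ∈ v.asIdeal) (h2' : (2 : 𝓞 (realField R)) ∈ v'.asIdeal) : v = v' :=
  dyadic_unique_of_sq_sub_self_notMem (finrank_realField_quadratic hR) v v' h2 h2'
    (zeta5_sq_sub_self_notMem hR hθ v h2) (zeta5_sq_sub_self_notMem hR hθ v' h2')

omit [Fact (Irreducible (cmPolyQ R))] in
/-- … and `ord_{v₂} 2 = 1` (`2` is unramified in `ℚ(√5)`). [folklore] -/
theorem zeta5_log_valuation_two (hR : R = X ^ 2 + C 5 * X + C 5) {θₒ : 𝓞 (realField R)}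
    (hθ : (θₒ : realField R) = AdjoinRoot.root (realPolyQ R)) (v : HeightOneSpectrum (𝓞 (realField R)))
    (h2 : (2 : 𝓞 (realField R)) ∈ v.asIdeal) :
    WithZero.log (v.valuation (realField R) (2 : realField R)) = -1 := by
  rw [show (2 : realField R) = algebraMap (𝓞 (realField R)) (realField R) 2 by rw [map_ofNat],
    HeightOneSpectrum.valuation_of_algebraMap,
    intValuation_two_of_dyadic_of_sq_sub_self_notMem (finrank_realField_quadratic hR) v h2
      (zeta5_sq_sub_self_notMem hR hθ v h2), WithZero.log_exp]

omit [Fact (Irreducible (cmPolyQ R))] in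
/-- **The dyadic place of `ℚ(√5)` is INERT in `ℚ(ζ₅)`**: `X² - X - (θ + 1)` has no root modulo `v₂` (its image in
`𝔽₄ = 𝔽₂(θ̄)` has Artin–Schreier trace `θ̄ + θ̄² = 1`; in the kernel: `r⁴ ≡ r` and the relation force `1 ∈ v`).
[folklore] -/
theorem zeta5_dyadic_inert (hR : R = X ^ 2 + C 5 * X + C 5) {θₒ : 𝓞 (realField R)}
    (hθ : (θₒ : realField R) = AdjoinRoot.root (realPolyQ R)) (v : HeightOneSpectrum (𝓞 (realField R)))
    (h2 : (2 : 𝓞 (realField R)) ∈ v.asIdeal) :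
    ∀ r : 𝓞 (realField R), r ^ 2 - r - (θₒ + 1) ∉ v.asIdeal := by
  intro r hr
  have hrel : θₒ ^ 2 + 5 * θₒ + 5 = 0 := by simpa using ringOfIntegers_root_rel_quadratic hR hθ
  have h4 := pow_four_sub_self_mem_of_dyadic (finrank_realField_quadratic hR) v h2 r
  have key : (1 : 𝓞 (realField R)) = (θₒ ^ 2 + 5 * θₒ + 5) +
      (r ^ 2 - r - (θₒ + 1)) * (3 + 2 * r + 2 * θₒ + (r ^ 2 - r - (θₒ + 1))) +
      2 * (r * θₒ + r - θₒ - 1) - (r ^ 4 - r) := by ring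
  have hmem : (1 : 𝓞 (realField R)) ∈ v.asIdeal := by
    rw [key, hrel, zero_add]
    exact v.asIdeal.sub_mem (v.asIdeal.add_mem (v.asIdeal.mul_mem_right _ hr) (v.asIdeal.mul_mem_right _ h2)) h4
  exact v.isPrime.ne_top ((Ideal.eq_top_iff_one _).2 hmem)

/-- **THE DYADIC COLUMN OF THE `ℚ(ζ₅)` TABLE: `v₂ ∈ T(q) ⟺ ord_{v₂} q` odd** (`= ord₂` on `ℚ`), for every `q ∈ F^×` —
the dyadic place of `ℚ(√5)` behaves exactly like an inert odd place (§b03.5: `T(2) = {2, ·}`-type rows, the «dyadic row»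
`[2] ≠ [1]` of §b03.12 by Eisenstein descent, now uniformly). [cite: Omeara1963, §63C Example 63:16]
[cite: Deligne1982HodgeCycles, §4 (1)] -/
theorem zeta5_inl_mem_badPlaces_iff_odd_of_dyadic (hR : R = X ^ 2 + C 5 * X + C 5) {θₒ : 𝓞 (realField R)}
    (hθ : (θₒ : realField R) = AdjoinRoot.root (realPolyQ R)) (v : HeightOneSpectrum (𝓞 (realField R)))
    (h2 : (2 : 𝓞 (realField R)) ∈ v.asIdeal) (q : (realField R)ˣ) :
    Sum.inl v ∈ badPlaces (q : realField R) (AdjoinRoot.root (realPolyQ R)) ↔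
      Odd (WithZero.log (v.valuation (realField R) (q : realField R))) :=
  inl_mem_badPlaces_iff_odd_of_dyadic_inert (zeta5_root_eq_sq_mul_one_add_four_mul hR hθ) v h2
    (zeta5_dyadic_inert hR hθ v h2) q

/-- **The dyadic rows of `ℚ(ζ₅)`**: `[2w] ≠ [(-1)^k]` for every `v₂`-unit `w ∈ 𝓞_F` (e.g. every odd integer) and every
`E`-rank `2k` (`ord_{v₂}(2w) = 1`). [cite: Deligne1982HodgeCycles, §4 (1) and Cor. 4.2] [cite: Omeara1963, §63C Example 63:16] -/
theorem zeta5_mk_two_mul_ne_splitDiscriminantClassCM (hR : R = X ^ 2 + C 5 * X + C 5) {θₒ : 𝓞 (realField R)}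
    (hθ : (θₒ : realField R) = AdjoinRoot.root (realPolyQ R)) (v : HeightOneSpectrum (𝓞 (realField R)))
    (h2 : (2 : 𝓞 (realField R)) ∈ v.asIdeal) {w : 𝓞 (realField R)} (hw : w ∉ v.asIdeal) (q : (realField R)ˣ)
    (hq : (q : realField R) = 2 * (w : realField R)) (k : ℕ) :
    (QuotientGroup.mk q : cmNormResidueGroup R) ≠ splitDiscriminantClassCM R k := by
  refine mk_ne_splitDiscriminantClassCM_of_odd_log_valuation_dyadic (zeta5_root_eq_sq_mul_one_add_four_mul hR hθ) v h2
    (zeta5_dyadic_inert hR hθ v h2) ?_ k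
  have h20 : v.valuation (realField R) (2 : realField R) ≠ 0 := (Valuation.ne_zero_iff _).2 two_ne_zero
  have hw0 : v.valuation (realField R) (w : realField R) ≠ 0 := by
    refine (Valuation.ne_zero_iff _).2 fun h ↦ hw ?_
    rw [show w = 0 from RingOfIntegers.coe_injective (by simpa using h)]
    exact v.asIdeal.zero_mem
  have hw1 : WithZero.log (v.valuation (realField R) (w : realField R)) = 0 := by
    rw [show (w : realField R) = algebraMap (𝓞 (realField R)) (realField R) w from rfl,
      HeightOneSpectrum.valuation_of_algebraMap, HeightOneSpectrum.intValuation_eq_one_iff.2 hw, WithZero.log_one]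
  rw [hq, map_mul, WithZero.log_mul h20 hw0, zeta5_log_valuation_two hR hθ v h2, hw1]
  decide

end Zeta5

/-! ### §16 `E = ℚ(ζ₁₂)`, `F = ℚ(√3)`, `R = S² + 8S + 4`: the dyadic place is INERT and RAMIFIED over `ℚ` —
`v₂ ∈ T(q) ⟺ ord_{v₂} q` odd, so NO integer row contains `v₂` -/

section Zeta12

variable {R : Polynomial ℤ} [Fact (Irreducible (cmPolyQ R))] [Fact (Irreducible (realPolyQ R))]

omit [Fact (Irreducible (cmPolyQ R))] in
/-- `√3 = (θ + 4)/2 ∈ 𝓞_F` for `F = ℚ[S]/(S² + 8S + 4)` (`θ = -4 ± 2√3`): an algebraic integer with square `3`.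
[folklore] -/
theorem zeta12_exists_sqrtThree (hR : R = X ^ 2 + C 8 * X + C 4) :
    ∃ s : 𝓞 (realField R), (s : realField R) = (AdjoinRoot.root (realPolyQ R) + 4) / 2 ∧ s ^ 2 = 3 := by
  have hrel := root_rel_quadratic hR
  push_cast at hrel
  have hsq : ((AdjoinRoot.root (realPolyQ R) + 4) / 2) ^ 2 = (3 : realField R) := by
    field_simp
    linear_combination hrel
  have hint : IsIntegral ℤ ((AdjoinRoot.root (realPolyQ R) + 4) / 2) := by
    refine ⟨X ^ 2 - C 3, by monicity!, ?_⟩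
    simp [hsq]
  refine ⟨⟨_, hint⟩, rfl, ?_⟩
  refine RingOfIntegers.ext ?_
  simp only [map_pow, map_ofNat]
  exact hsq

omit [Fact (Irreducible (cmPolyQ R))] in
/-- `2` RAMIFIES in `ℚ(√3)`: `(1 + √3)² = 2(2 + √3)` with `2 + √3` a unit. [folklore] -/
theorem zeta12_exists_sq_eq_two_mul_unit (hR : R = X ^ 2 + C 8 * X + C 4) :
    ∃ π u : 𝓞 (realField R), IsUnit u ∧ π ^ 2 = 2 * u := by
  obtain ⟨s, -, hs⟩ := zeta12_exists_sqrtThree hR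
  refine ⟨1 + s, 2 + s, ?_, by linear_combination hs⟩
  refine isUnit_iff_exists_inv.2 ⟨2 - s, by linear_combination (-1 : 𝓞 (realField R)) * hs⟩

omit [Fact (Irreducible (cmPolyQ R))] in
/-- **Dyadic normalisation of the `ℚ(ζ₁₂)` carrier**: `θ = ((θ+2)/(θ+4))²·(1 + 4·(-1))` (`θ = -(1 ∓ √3)²`, `3 ∈ F²`,
so `E = F(√θ) = F(√-3)`). [folklore] -/
theorem zeta12_root_eq_sq_mul_one_add_four_mul (hR : R = X ^ 2 + C 8 * X + C 4) :
    AdjoinRoot.root (realPolyQ R) =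
      ((AdjoinRoot.root (realPolyQ R) + 2) * (AdjoinRoot.root (realPolyQ R) + 4)⁻¹) ^ 2 *
        ((1 + 4 * (-1) : 𝓞 (realField R)) : realField R) := by
  have hrel := root_rel_quadratic hR
  push_cast at hrel
  have h4 : AdjoinRoot.root (realPolyQ R) + 4 ≠ 0 := by
    intro h
    have : AdjoinRoot.root (realPolyQ R) = -4 := by linear_combination h
    rw [this] at hrel
    norm_num at hrel
  simp only [map_add, map_mul, map_one, map_ofNat, map_neg]
  field_simp
  linear_combination (AdjoinRoot.root (realPolyQ R) + 3) * hrel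

omit [Fact (Irreducible (cmPolyQ R))] in
/-- **The dyadic place of `ℚ(√3)` has residue field `𝔽₂`**: `x² ≡ x (mod v₂)` for every `x ∈ 𝓞_F`. [folklore] -/
theorem zeta12_sq_sub_self_mem_of_dyadic (hR : R = X ^ 2 + C 8 * X + C 4) (v : HeightOneSpectrum (𝓞 (realField R)))
    (h2 : (2 : 𝓞 (realField R)) ∈ v.asIdeal) (x : 𝓞 (realField R)) : x ^ 2 - x ∈ v.asIdeal := by
  obtain ⟨π, u, hu, hπ⟩ := zeta12_exists_sq_eq_two_mul_unit hR
  exact sq_sub_self_mem_of_dyadic_of_sq_eq_two_mul_unit (finrank_realField_quadratic hR) hu hπ v h2 x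

omit [Fact (Irreducible (cmPolyQ R))] in
/-- … it is the UNIQUE dyadic place of `ℚ(√3)`. [folklore] -/
theorem zeta12_dyadic_unique (hR : R = X ^ 2 + C 8 * X + C 4) (v v' : HeightOneSpectrum (𝓞 (realField R)))
    (h2 : (2 : 𝓞 (realField R)) ∈ v.asIdeal) (h2' : (2 : 𝓞 (realField R)) ∈ v'.asIdeal) : v = v' := by
  obtain ⟨π, u, hu, hπ⟩ := zeta12_exists_sq_eq_two_mul_unit hR
  exact dyadic_unique_of_sq_eq_two_mul_unit (finrank_realField_quadratic hR) hu hπ v v' h2 h2'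

omit [Fact (Irreducible (cmPolyQ R))] in
/-- … and `ord_{v₂} 2 = 2`. [folklore] -/
theorem zeta12_log_valuation_two (hR : R = X ^ 2 + C 8 * X + C 4) (v : HeightOneSpectrum (𝓞 (realField R)))
    (h2 : (2 : 𝓞 (realField R)) ∈ v.asIdeal) :
    WithZero.log (v.valuation (realField R) (2 : realField R)) = -2 := by
  obtain ⟨π, u, hu, hπ⟩ := zeta12_exists_sq_eq_two_mul_unit hR
  rw [show (2 : realField R) = algebraMap (𝓞 (realField R)) (realField R) 2 by rw [map_ofNat],
    HeightOneSpectrum.valuation_of_algebraMap,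
    intValuation_two_of_dyadic_of_sq_eq_two_mul_unit (finrank_realField_quadratic hR) hu hπ v h2, WithZero.log_exp]

omit [Fact (Irreducible (cmPolyQ R))] in
/-- **The dyadic place of `ℚ(√3)` is INERT in `ℚ(ζ₁₂)`**: `X² - X + 1` has no root modulo `v₂` (no primitive cube root
of unity in `𝔽₂`). [folklore] -/
theorem zeta12_dyadic_inert (hR : R = X ^ 2 + C 8 * X + C 4) (v : HeightOneSpectrum (𝓞 (realField R)))
    (h2 : (2 : 𝓞 (realField R)) ∈ v.asIdeal) :
    ∀ r : 𝓞 (realField R), r ^ 2 - r - (-1) ∉ v.asIdeal := by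
  intro r hr
  have h1 : (1 : 𝓞 (realField R)) ∈ v.asIdeal := by
    have := v.asIdeal.sub_mem hr (zeta12_sq_sub_self_mem_of_dyadic hR v h2 r)
    simpa using this
  exact v.isPrime.ne_top ((Ideal.eq_top_iff_one _).2 h1)

/-- **THE DYADIC COLUMN OF THE `ℚ(ζ₁₂)` TABLE: `v₂ ∈ T(q) ⟺ ord_{v₂} q` odd**, for every `q ∈ F^×`.
[cite: Omeara1963, §63C Example 63:16] [cite: Deligne1982HodgeCycles, §4 (1)] -/
theorem zeta12_inl_mem_badPlaces_iff_odd_of_dyadic (hR : R = X ^ 2 + C 8 * X + C 4)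
    (v : HeightOneSpectrum (𝓞 (realField R))) (h2 : (2 : 𝓞 (realField R)) ∈ v.asIdeal) (q : (realField R)ˣ) :
    Sum.inl v ∈ badPlaces (q : realField R) (AdjoinRoot.root (realPolyQ R)) ↔
      Odd (WithZero.log (v.valuation (realField R) (q : realField R))) :=
  inl_mem_badPlaces_iff_odd_of_dyadic_inert (zeta12_root_eq_sq_mul_one_add_four_mul hR) v h2
    (zeta12_dyadic_inert hR v h2) q

/-- **NO INTEGER ROW OF THE `ℚ(ζ₁₂)` TABLE CONTAINS THE DYADIC PLACE**: for `q = 2^a·w`, `w ∈ 𝓞_F` a `v₂`-unit (e.g. an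
odd integer), `ord_{v₂} q = 2a` is even, so `v₂ ∉ T(q)` (§b03.5: every `T`-set of the `ℚ(ζ₁₂)` table avoids `2`;
§b03.16: `[ℓ] ≠ [1] ⟺ ℓ ≡ 11 (12)` with `T(ℓ) = {λ, λ'}`). [cite: Omeara1963, §63C Example 63:16]
[cite: Deligne1982HodgeCycles, §4 (1)] -/
theorem zeta12_inl_notMem_badPlaces_two_pow_mul_of_dyadic (hR : R = X ^ 2 + C 8 * X + C 4)
    (v : HeightOneSpectrum (𝓞 (realField R))) (h2 : (2 : 𝓞 (realField R)) ∈ v.asIdeal) {w : 𝓞 (realField R)}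
    (hw : w ∉ v.asIdeal) (a : ℕ) (q : (realField R)ˣ) (hq : (q : realField R) = 2 ^ a * (w : realField R)) :
    Sum.inl v ∉ badPlaces (q : realField R) (AdjoinRoot.root (realPolyQ R)) := by
  rw [zeta12_inl_mem_badPlaces_iff_odd_of_dyadic hR v h2, Int.not_odd_iff_even]
  have h20 : v.valuation (realField R) (2 : realField R) ≠ 0 := (Valuation.ne_zero_iff _).2 two_ne_zero
  have hw0 : v.valuation (realField R) (w : realField R) ≠ 0 := by
    refine (Valuation.ne_zero_iff _).2 fun h ↦ hw ?_
    rw [show w = 0 from RingOfIntegers.coe_injective (by simpa using h)]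
    exact v.asIdeal.zero_mem
  have hw1 : WithZero.log (v.valuation (realField R) (w : realField R)) = 0 := by
    rw [show (w : realField R) = algebraMap (𝓞 (realField R)) (realField R) w from rfl,
      HeightOneSpectrum.valuation_of_algebraMap, HeightOneSpectrum.intValuation_eq_one_iff.2 hw, WithZero.log_one]
  rw [hq, map_mul, map_pow, WithZero.log_mul (pow_ne_zero _ h20) hw0, WithZero.log_pow, zeta12_log_valuation_two hR v h2,
    hw1]
  exact ⟨-(a : ℤ), by ring⟩

end Zeta12

/-! ### §17 `E = ℚ(√-3, √5)`, `F = ℚ(√5)`, `R = S² + 9S + 9`: the dyadic place is SPLIT — it lies in NO `T(q)` -/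

section SqrtNeg3Sqrt5

variable {R : Polynomial ℤ} [Fact (Irreducible (cmPolyQ R))] [Fact (Irreducible (realPolyQ R))]

omit [Fact (Irreducible (cmPolyQ R))] in
/-- **Dyadic normalisation of the `ℚ(√-3,√5)` carrier**: `θ = ((θ + 3)/3)²·(1 + 4·(-1))` (`θ = -3·((1 ∓ √5)/2)²`,
`E = F(√-3)`). [folklore] -/
theorem sqrtNeg3Sqrt5_root_eq_sq_mul_one_add_four_mul (hR : R = X ^ 2 + C 9 * X + C 9) :
    AdjoinRoot.root (realPolyQ R) =
      ((AdjoinRoot.root (realPolyQ R) + 3) / 3) ^ 2 * ((1 + 4 * (-1) : 𝓞 (realField R)) : realField R) := by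
  have hrel := root_rel_quadratic hR
  push_cast at hrel
  simp only [map_add, map_mul, map_one, map_ofNat, map_neg]
  field_simp
  linear_combination 3 * hrel

omit [Fact (Irreducible (cmPolyQ R))] in
/-- **The dyadic place of `ℚ(√5)` is SPLIT in `ℚ(√-3,√5)`**: `r = θ` is a root of `X² - X + 1` modulo `v₂`
(`θ² - θ + 1 = -2(5θ + 4)`; `𝔽₄ ∋` the cube roots of unity; `2` splits in `ℚ(√-15) ⊂ E`). [folklore] -/
theorem sqrtNeg3Sqrt5_dyadic_split (hR : R = X ^ 2 + C 9 * X + C 9) {θₒ : 𝓞 (realField R)}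
    (hθ : (θₒ : realField R) = AdjoinRoot.root (realPolyQ R)) (v : HeightOneSpectrum (𝓞 (realField R)))
    (h2 : (2 : 𝓞 (realField R)) ∈ v.asIdeal) : ∃ r : 𝓞 (realField R), r ^ 2 - r - (-1) ∈ v.asIdeal := by
  have hrel : θₒ ^ 2 + 9 * θₒ + 9 = 0 := by simpa using ringOfIntegers_root_rel_quadratic hR hθ
  refine ⟨θₒ, ?_⟩
  have key : θₒ ^ 2 - θₒ - (-1) = (θₒ ^ 2 + 9 * θₒ + 9) - 2 * (5 * θₒ + 4) := by ring
  rw [key, hrel, zero_sub]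
  exact v.asIdeal.neg_mem (v.asIdeal.mul_mem_right _ h2)

/-- **THE DYADIC COLUMN OF THE `ℚ(√-3,√5)` TABLE IS EMPTY: `v₂ ∉ T(q)` for every `q ∈ F^×`** (§b03.5: no `T`-set of the
`ℚ(√-3,√5)` table contains `2`; §b03.16: `[ℓ] ≠ [1] ⟺ ℓ ≡ 11, 14 (15)`). [cite: Omeara1963, §63C Example 63:16]
[cite: Deligne1982HodgeCycles, §4 (1)] -/
theorem sqrtNeg3Sqrt5_inl_notMem_badPlaces_of_dyadic (hR : R = X ^ 2 + C 9 * X + C 9) {θₒ : 𝓞 (realField R)}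
    (hθ : (θₒ : realField R) = AdjoinRoot.root (realPolyQ R)) (v : HeightOneSpectrum (𝓞 (realField R)))
    (h2 : (2 : 𝓞 (realField R)) ∈ v.asIdeal) (q : (realField R)ˣ) :
    Sum.inl v ∉ badPlaces (q : realField R) (AdjoinRoot.root (realPolyQ R)) :=
  inl_notMem_badPlaces_of_dyadic_split (sqrtNeg3Sqrt5_root_eq_sq_mul_one_add_four_mul hR) v h2
    (sqrtNeg3Sqrt5_dyadic_split hR hθ v h2) q

omit [Fact (Irreducible (cmPolyQ R))] in
/-- `θ² - θ ∉ v₂` here too (`θ² - θ = -10θ - 9 ≡ 1`): the dyadic place of `ℚ(√5)` is `(2)`, unique, with `ord 2 = 1`,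
also in this carrier's terms. [folklore] -/
theorem sqrtNeg3Sqrt5_sq_sub_self_notMem (hR : R = X ^ 2 + C 9 * X + C 9) {θₒ : 𝓞 (realField R)}
    (hθ : (θₒ : realField R) = AdjoinRoot.root (realPolyQ R)) (v : HeightOneSpectrum (𝓞 (realField R)))
    (h2 : (2 : 𝓞 (realField R)) ∈ v.asIdeal) : θₒ ^ 2 - θₒ ∉ v.asIdeal := by
  have hrel : θₒ ^ 2 + 9 * θₒ + 9 = 0 := by simpa using ringOfIntegers_root_rel_quadratic hR hθ
  intro h
  have h1 : (1 : 𝓞 (realField R)) = (θₒ ^ 2 + 9 * θₒ + 9) - (θₒ ^ 2 - θₒ) - 2 * (5 * θₒ + 4) := by ring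
  rw [hrel, zero_sub] at h1
  have hmem : (1 : 𝓞 (realField R)) ∈ v.asIdeal := by
    rw [h1]
    exact v.asIdeal.sub_mem (v.asIdeal.neg_mem h) (v.asIdeal.mul_mem_right _ h2)
  exact v.isPrime.ne_top ((Ideal.eq_top_iff_one _).2 hmem)

omit [Fact (Irreducible (cmPolyQ R))] in
/-- … so the dyadic place is unique for this carrier as well. [folklore] -/
theorem sqrtNeg3Sqrt5_dyadic_unique (hR : R = X ^ 2 + C 9 * X + C 9) {θₒ : 𝓞 (realField R)}
    (hθ : (θₒ : realField R) = AdjoinRoot.root (realPolyQ R)) (v v' : HeightOneSpectrum (𝓞 (realField R)))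
    (h2 : (2 : 𝓞 (realField R)) ∈ v.asIdeal) (h2' : (2 : 𝓞 (realField R)) ∈ v'.asIdeal) : v = v' :=
  dyadic_unique_of_sq_sub_self_notMem (finrank_realField_quadratic hR) v v' h2 h2'
    (sqrtNeg3Sqrt5_sq_sub_self_notMem hR hθ v h2) (sqrtNeg3Sqrt5_sq_sub_self_notMem hR hθ v' h2')

end SqrtNeg3Sqrt5

end Summit.HodgeConjecture.HodgeConjecture.Ring2.WeilCoverageCM

end
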